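import Summits.Parity.GeneralizedHardyLittlewood.Theses.LinnikGallagherMV
import Literature.NumberTheory.Sieve.GoldbachLinnikPointwiseMajorArcsMV

/-!
# Route `LinnikGallagherMV` — crux `PointwiseMajorArcsMV` (stmt-Parity-20512)

The deciding crux of the route — POINTWISE MAJOR ARCS WITH THE EXCEPTIONAL PRIME BUILT IN
(Montgomery–Vaughan 1975 §§4–8 at a fixed power level, the possible exceptional character carried
through Page + Deuring–Heilbronn) — is VERBATIM the tree theorem
`Literature.NumberTheory.Sieve.GoldbachLinnik.pointwiseMajorArcsMV`
(`Literature/NumberTheory/Sieve/GoldbachLinnikPointwiseMajorArcsMV.lean`, p542339); this file closes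
the item by `exact`.  Honesty label of the route (director-frontier 2026-08-27): a FORMALISATION floor
rung (F-LGE) of Parity — formalisation-first of Linnik 1953 / Gallagher 1975 over the tree's proved
Montgomery–Vaughan major arcs; no new mathematics, no value of `K`, never distance-to-Goldbach.

References: H. L. Montgomery, R. C. Vaughan, Acta Arith. 27 (1975) §§4–8 [MontgomeryVaughanActa1975];
P. X. Gallagher, Invent. Math. 29 (1975) [Gallagher1975].
-/

namespace Summit.Parity.GeneralizedHardyLittlewood.Theorems

/-- **Crux `PointwiseMajorArcsMV` PROVED** (item stmt-Parity-20512): there is `c₀ > 0` such that for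
every `κ > 0` there are `θ > 0`, measurable sets `𝔐_N ⊂ ℝ` and `p_N ∈ {0} ∪ {odd primes}` with
`p_N = 0` or `p_N → ∞`, such that eventually in `N`: `|A_N(α)| ≤ N^(1−θ)` for `α ∈ [0,1] ∖ 𝔐_N`, and for
every even `n` with `N/2 ≤ n ≤ N`, `R_𝔐(n) ≥ −κ𝔖(n)N`, and `R_𝔐(n) ≥ c₀𝔖(n)n − κ𝔖(n)N` whenever
`p_N ∤ n` — by the Literature theorem `GoldbachLinnik.pointwiseMajorArcsMV` (Montgomery–Vaughan 1975
(4.3)–(4.6), (7.1)–(7.4), §8). [cite: MontgomeryVaughanActa1975, §§4–8] -/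
theorem linnikGallagherMV_pointwiseMajorArcsMV_proof :
    Summit.Parity.GeneralizedHardyLittlewood.Theses.LinnikGallagherMV.PointwiseMajorArcsMV :=
  Literature.NumberTheory.Sieve.GoldbachLinnik.pointwiseMajorArcsMV

end Summit.Parity.GeneralizedHardyLittlewood.Theorems
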